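import Mathlib
import Summits.MatrixMultiplication.MatrixMultiplication.Theorems.HiddenToeplitzCornersHiddenCornerLemmaRStein
import Summits.MatrixMultiplication.MatrixMultiplication.Theorems.HiddenToeplitzCornersHiddenCornerLemmaRSmallD

/-!
# The x-side syzygy constraint on hidden corners of G-constant pencils

Support file for crux item `stmt-MatrixMultiplication-10752`
(`Summit.MatrixMultiplication.MatrixMultiplication.Theses.HiddenToeplitzCorners.HiddenCornerLemmaR`),
line `frobenius-dual-short-syzygies`, stub `hclR_syzygy_constraint`.

Setting.  `Z` is the lower shift on `ℂ^N` (`Z i j = [i = j + 1]`, written verbatim as in the crux),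
so `Z *ᵥ v` is multiplication by `x` on coefficient vectors, truncating the top coefficient.
A pencil `T(X) = Σ X_ab • T a b` with hidden corner `T(X) * E = F * X` is *G-constant* when every
coefficient has Stein displacement `T a b − Z (T a b) Zᵀ = G₀ (H₁ a b)ᵀ` with one generator
matrix `G₀`.

Statement (`hclR_syzygy_constraint`).  If `q : Fin r → ℂ[x]` has `deg (q i) ≤ k`, every column
`E_i` with `q i ≠ 0` vanishes in its top `k` coordinates (so that `(q i)(Z) *ᵥ E_i` is a
truncation-free polynomial multiple), and `Σ_i (q i)(Z) *ᵥ E_i = 0`, then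
`(q i₀)(Z) *ᵥ F_a ∈ M_k := span {Z^j *ᵥ (G₀)_l | j < k, l}` for every target column `F_a` of `F`
and every slot `i₀`.

Proof (elementary matrix algebra, folklore).
* `hclR_sd_disp_eval` (from the `SmallD` file): displacement is linear in the pencil parameter, so
  `S := T(X)` satisfies `S − Z S Zᵀ = G₀ Hᵀ` for some `H`.
* `hclR_syz_shift_step`: since `Zᵀ Z = diag(1, …, 1, 0)` (`hclR_syz_ZtZ_mulVec`), for `y` with
  vanishing last coordinate `S (Z y) = Z (S y) + G₀ (Hᵀ Z y)`; iterating
  (`hclR_syz_pow_comm_mem`) gives `S (Z^j y) − Z^j (S y) ∈ M_j` for `y` vanishing in its top `j`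
  coordinates, and by linearity (`hclR_syz_aeval_comm_mem`) `S (Q(Z) y) − Q(Z) (S y) ∈ M_k` for
  `deg Q ≤ k`.
* `hclR_syz_col_of_corner`, `hclR_syz_assemble`: with `X` the matrix unit at `(a, i₀)` the corner
  equation reads `S *ᵥ E_i = [i = i₀] • F_a`; applying `S` to the syzygy and reducing modulo `M_k`
  leaves `(q i₀)(Z) *ᵥ F_a ∈ M_k`.
-/

set_option linter.dupNamespace false

namespace Summit.MatrixMultiplication.MatrixMultiplication.Theorems

open scoped Matrix

/-- `Zᵀ Z = diag(1, …, 1, 0)`: the lower shift followed by the upper shift fixes every vector whose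
last coordinate vanishes. -/
theorem hclR_syz_ZtZ_mulVec {N : ℕ} (y : Fin N → ℂ) (hy : ∀ n : Fin N, N ≤ (n : ℕ) + 1 → y n = 0) :
    (Matrix.of fun i j : Fin N => if (i : ℕ) = (j : ℕ) + 1 then (1 : ℂ) else 0)ᵀ *ᵥ
      ((Matrix.of fun i j : Fin N => if (i : ℕ) = (j : ℕ) + 1 then (1 : ℂ) else 0) *ᵥ y) = y := by
  ext n
  have h1 := hclR_shiftT_pow_mulVec 1
    ((Matrix.of fun i j : Fin N => if (i : ℕ) = (j : ℕ) + 1 then (1 : ℂ) else 0) *ᵥ y) n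
  rw [pow_one] at h1
  rw [h1]
  by_cases h : (n : ℕ) + 1 < N
  · rw [dif_pos h]
    have h2 := hclR_shift_pow_mulVec 1 y ⟨(n : ℕ) + 1, h⟩
    rw [pow_one] at h2
    rw [h2]
    split_ifs with h'
    · congr 1
    · exfalso
      exact h' (Nat.le_add_left 1 _)
  · rw [dif_neg h, hy n (by omega)]

/-- Shift step: if `S − Z S Zᵀ = G₀ Hᵀ` and the last coordinate of `y` vanishes, then
`S (Z y) = Z (S y) + G₀ (Hᵀ (Z y))`. -/
theorem hclR_syz_shift_step {N p : ℕ} (S : Matrix (Fin N) (Fin N) ℂ)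
    (G₀ H : Matrix (Fin N) (Fin p) ℂ)
    (hS : S - (Matrix.of fun i j : Fin N => if (i : ℕ) = (j : ℕ) + 1 then (1 : ℂ) else 0) * S *
      (Matrix.of fun i j : Fin N => if (i : ℕ) = (j : ℕ) + 1 then (1 : ℂ) else 0)ᵀ = G₀ * Hᵀ)
    (y : Fin N → ℂ) (hy : ∀ n : Fin N, N ≤ (n : ℕ) + 1 → y n = 0) :
    S *ᵥ ((Matrix.of fun i j : Fin N => if (i : ℕ) = (j : ℕ) + 1 then (1 : ℂ) else 0) *ᵥ y) =
      (Matrix.of fun i j : Fin N => if (i : ℕ) = (j : ℕ) + 1 then (1 : ℂ) else 0) *ᵥ (S *ᵥ y) +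
        G₀ *ᵥ (Hᵀ *ᵥ
          ((Matrix.of fun i j : Fin N => if (i : ℕ) = (j : ℕ) + 1 then (1 : ℂ) else 0) *ᵥ y)) := by
  have hS' := sub_eq_iff_eq_add.mp hS
  conv_lhs => rw [hS']
  simp only [Matrix.add_mulVec, ← Matrix.mulVec_mulVec]
  rw [hclR_syz_ZtZ_mulVec y hy, add_comm]

/-- The column space of `G₀` lies in `M_j = span {Z^m *ᵥ (G₀)_l | m < j, l}` as soon as `0 < j`. -/
theorem hclR_syz_G0_mulVec_mem {N p : ℕ} (G₀ : Matrix (Fin N) (Fin p) ℂ) (w : Fin p → ℂ) (j : ℕ)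
    (hj : 0 < j) :
    G₀ *ᵥ w ∈ Submodule.span ℂ {v : Fin N → ℂ | ∃ (m : ℕ) (l : Fin p), m < j ∧
      v = ((Matrix.of fun i j : Fin N => if (i : ℕ) = (j : ℕ) + 1 then (1 : ℂ) else 0) ^ m) *ᵥ
        (fun n => G₀ n l)} := by
  have hw : G₀ *ᵥ w = ∑ l : Fin p, w l • (fun n => G₀ n l) := by
    ext n
    simp only [Matrix.mulVec, dotProduct, Finset.sum_apply, Pi.smul_apply, smul_eq_mul]
    exact Finset.sum_congr rfl (fun l _ => mul_comm _ _)
  rw [hw]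
  refine Submodule.sum_mem _ (fun l _ => Submodule.smul_mem _ _ (Submodule.subset_span ⟨0, l, hj, ?_⟩))
  rw [pow_zero, Matrix.one_mulVec]

/-- The shift maps `M_j` into `M_{j+1}`. -/
theorem hclR_syz_shift_mem {N p : ℕ} (G₀ : Matrix (Fin N) (Fin p) ℂ) (j : ℕ) (v : Fin N → ℂ)
    (hv : v ∈ Submodule.span ℂ {v : Fin N → ℂ | ∃ (m : ℕ) (l : Fin p), m < j ∧
      v = ((Matrix.of fun i j : Fin N => if (i : ℕ) = (j : ℕ) + 1 then (1 : ℂ) else 0) ^ m) *ᵥ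
        (fun n => G₀ n l)}) :
    (Matrix.of fun i j : Fin N => if (i : ℕ) = (j : ℕ) + 1 then (1 : ℂ) else 0) *ᵥ v ∈
      Submodule.span ℂ {v : Fin N → ℂ | ∃ (m : ℕ) (l : Fin p), m < j + 1 ∧
        v = ((Matrix.of fun i j : Fin N => if (i : ℕ) = (j : ℕ) + 1 then (1 : ℂ) else 0) ^ m) *ᵥ
          (fun n => G₀ n l)} := by
  induction hv using Submodule.span_induction with
  | mem x hx =>
    obtain ⟨m, l, hm, rfl⟩ := hx
    rw [Matrix.mulVec_mulVec, ← pow_succ']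
    exact Submodule.subset_span ⟨m + 1, l, by omega, rfl⟩
  | zero =>
    rw [Matrix.mulVec_zero]
    exact Submodule.zero_mem _
  | add x y _ _ hx hy =>
    rw [Matrix.mulVec_add]
    exact Submodule.add_mem _ hx hy
  | smul c x _ hx =>
    rw [Matrix.mulVec_smul]
    exact Submodule.smul_mem _ c hx

/-- Monotonicity of `M_j` in `j`. -/
theorem hclR_syz_span_mono {N p : ℕ} (G₀ : Matrix (Fin N) (Fin p) ℂ) {j j' : ℕ} (h : j ≤ j') :
    Submodule.span ℂ {v : Fin N → ℂ | ∃ (m : ℕ) (l : Fin p), m < j ∧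
      v = ((Matrix.of fun i j : Fin N => if (i : ℕ) = (j : ℕ) + 1 then (1 : ℂ) else 0) ^ m) *ᵥ
        (fun n => G₀ n l)} ≤
      Submodule.span ℂ {v : Fin N → ℂ | ∃ (m : ℕ) (l : Fin p), m < j' ∧
        v = ((Matrix.of fun i j : Fin N => if (i : ℕ) = (j : ℕ) + 1 then (1 : ℂ) else 0) ^ m) *ᵥ
          (fun n => G₀ n l)} := by
  apply Submodule.span_mono
  rintro v ⟨m, l, hm, rfl⟩
  exact ⟨m, l, by omega, rfl⟩

/-- Iterated shift step: if `S − Z S Zᵀ = G₀ Hᵀ` and `y` vanishes in its top `j` coordinates, then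
`S (Z^j y) − Z^j (S y) ∈ M_j`. -/
theorem hclR_syz_pow_comm_mem {N p : ℕ} (S : Matrix (Fin N) (Fin N) ℂ)
    (G₀ H : Matrix (Fin N) (Fin p) ℂ)
    (hS : S - (Matrix.of fun i j : Fin N => if (i : ℕ) = (j : ℕ) + 1 then (1 : ℂ) else 0) * S *
      (Matrix.of fun i j : Fin N => if (i : ℕ) = (j : ℕ) + 1 then (1 : ℂ) else 0)ᵀ = G₀ * Hᵀ)
    (j : ℕ) :
    ∀ y : Fin N → ℂ, (∀ n : Fin N, N ≤ (n : ℕ) + j → y n = 0) →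
      S *ᵥ ((Matrix.of fun i j : Fin N => if (i : ℕ) = (j : ℕ) + 1 then (1 : ℂ) else 0) ^ j *ᵥ y) -
        (Matrix.of fun i j : Fin N => if (i : ℕ) = (j : ℕ) + 1 then (1 : ℂ) else 0) ^ j *ᵥ
          (S *ᵥ y) ∈
        Submodule.span ℂ {v : Fin N → ℂ | ∃ (m : ℕ) (l : Fin p), m < j ∧
          v = ((Matrix.of fun i j : Fin N => if (i : ℕ) = (j : ℕ) + 1 then (1 : ℂ) else 0) ^ m) *ᵥ
            (fun n => G₀ n l)} := by
  induction j with
  | zero =>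
    intro y _
    simp only [pow_zero, Matrix.one_mulVec, sub_self]
    exact Submodule.zero_mem _
  | succ j ih =>
    intro y hy
    have hy' : ∀ n : Fin N, N ≤ (n : ℕ) + j → y n = 0 := fun n hn => hy n (by omega)
    rw [pow_succ', ← Matrix.mulVec_mulVec, ← Matrix.mulVec_mulVec,
      hclR_syz_shift_step S G₀ H hS _ ?_]
    · rw [add_sub_right_comm, ← Matrix.mulVec_sub]
      exact Submodule.add_mem _ (hclR_syz_shift_mem G₀ j _ (ih y hy'))
        (hclR_syz_G0_mulVec_mem G₀ _ (j + 1) (Nat.succ_pos j))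
    · intro n hn
      rw [hclR_shift_pow_mulVec]
      split_ifs with h
      · exact hy _ (by show N ≤ (n : ℕ) - j + (j + 1); omega)
      · rfl

/-- Polynomial version: if `S − Z S Zᵀ = G₀ Hᵀ`, `deg Q ≤ k` and `y` vanishes in its top `k`
coordinates, then `S (Q(Z) y) − Q(Z) (S y) ∈ M_k`. -/
theorem hclR_syz_aeval_comm_mem {N p : ℕ} (S : Matrix (Fin N) (Fin N) ℂ)
    (G₀ H : Matrix (Fin N) (Fin p) ℂ)
    (hS : S - (Matrix.of fun i j : Fin N => if (i : ℕ) = (j : ℕ) + 1 then (1 : ℂ) else 0) * S *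
      (Matrix.of fun i j : Fin N => if (i : ℕ) = (j : ℕ) + 1 then (1 : ℂ) else 0)ᵀ = G₀ * Hᵀ)
    (k : ℕ) (Q : Polynomial ℂ) (hQ : Q.natDegree ≤ k)
    (y : Fin N → ℂ) (hy : ∀ n : Fin N, N ≤ (n : ℕ) + k → y n = 0) :
    S *ᵥ ((Polynomial.aeval
        (Matrix.of fun i j : Fin N => if (i : ℕ) = (j : ℕ) + 1 then (1 : ℂ) else 0) Q) *ᵥ y) -
      (Polynomial.aeval
        (Matrix.of fun i j : Fin N => if (i : ℕ) = (j : ℕ) + 1 then (1 : ℂ) else 0) Q) *ᵥ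
        (S *ᵥ y) ∈
      Submodule.span ℂ {v : Fin N → ℂ | ∃ (m : ℕ) (l : Fin p), m < k ∧
        v = ((Matrix.of fun i j : Fin N => if (i : ℕ) = (j : ℕ) + 1 then (1 : ℂ) else 0) ^ m) *ᵥ
          (fun n => G₀ n l)} := by
  rw [Polynomial.aeval_eq_sum_range' (Nat.lt_succ_of_le hQ), Matrix.sum_mulVec, Matrix.sum_mulVec,
    Matrix.mulVec_sum, ← Finset.sum_sub_distrib]
  refine Submodule.sum_mem _ (fun j hj => ?_)
  rw [Finset.mem_range] at hj
  rw [Matrix.smul_mulVec, Matrix.smul_mulVec, Matrix.mulVec_smul, ← smul_sub]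
  exact Submodule.smul_mem _ _ (hclR_syz_span_mono G₀ (by omega)
    (hclR_syz_pow_comm_mem S G₀ H hS j y (fun n hn => hy n (by omega))))

/-- Column extraction from the corner equation with the matrix unit `X = e_a e_{i₀}ᵀ`:
`S *ᵥ E_i = [i = i₀] • F_a`. -/
theorem hclR_syz_col_of_corner {r N : ℕ} (S : Matrix (Fin N) (Fin N) ℂ)
    (E F : Matrix (Fin N) (Fin r) ℂ) (i₀ a : Fin r)
    (h : S * E = F * Matrix.single a i₀ (1 : ℂ)) (i : Fin r) :
    S *ᵥ (fun n => E n i) = if i = i₀ then (fun n => F n a) else 0 := by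
  have hc : S *ᵥ (fun n => E n i) = fun n => (S * E) n i := rfl
  rw [hc, h]
  by_cases hi : i = i₀
  · rw [if_pos hi, hi]
    ext n
    rw [Matrix.mul_single_apply_same, mul_one]
  · rw [if_neg hi]
    ext n
    rw [Matrix.mul_single_apply_of_ne (hbj := hi), Pi.zero_apply]

/-- Assembly: if `S *ᵥ e_i = [i = i₀] • f`, every commutator `S (A_i e_i) − A_i (S e_i)` lies in
`M`, and `Σ_i A_i e_i = 0`, then `A_{i₀} f ∈ M`. -/
theorem hclR_syz_assemble {r N : ℕ} (M : Submodule ℂ (Fin N → ℂ)) (S : Matrix (Fin N) (Fin N) ℂ)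
    (A : Fin r → Matrix (Fin N) (Fin N) ℂ) (e : Fin r → Fin N → ℂ) (f : Fin N → ℂ) (i₀ : Fin r)
    (hcol : ∀ i : Fin r, S *ᵥ e i = if i = i₀ then f else 0)
    (hmem : ∀ i : Fin r, S *ᵥ (A i *ᵥ e i) - A i *ᵥ (S *ᵥ e i) ∈ M)
    (hsyz : ∑ i : Fin r, A i *ᵥ e i = 0) :
    A i₀ *ᵥ f ∈ M := by
  have h0 : ∑ i : Fin r, S *ᵥ (A i *ᵥ e i) = 0 := by
    rw [← Matrix.mulVec_sum, hsyz, Matrix.mulVec_zero]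
  have hsum : ∑ i : Fin r, (S *ᵥ (A i *ᵥ e i) - A i *ᵥ (S *ᵥ e i)) ∈ M :=
    Submodule.sum_mem M (fun i _ => hmem i)
  rw [Finset.sum_sub_distrib, h0, zero_sub, neg_mem_iff, Finset.sum_eq_single i₀, hcol i₀,
    if_pos rfl] at hsum
  · exact hsum
  · intro i _ hi
    rw [hcol i, if_neg hi, Matrix.mulVec_zero]
  · intro h
    exact absurd (Finset.mem_univ i₀) h

/-- **The x-side syzygy constraint on hidden corners of G-constant pencils.**  For a G-constant
pencil `T(X) = Σ X_ab • T a b` (`∇(T a b) = G₀ (H₁ a b)ᵀ`) with hidden corner `T(X) E = F X`: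
a truncation-free multiplicative syzygy `Σ_i (q i)(Z) *ᵥ E_i = 0` of the frame `E`
(`deg (q i) ≤ k`, and `E_i` vanishing in its top `k` coordinates whenever `q i ≠ 0`) forces
`(q i₀)(Z) *ᵥ F_a ∈ span {Z^j *ᵥ (G₀)_l | j < k, l}` for every slot `i₀` and target column `F_a`. -/
theorem hclR_syzygy_constraint : ∀ (r N p k : ℕ) (T : Fin r → Fin r → Matrix (Fin N) (Fin N) ℂ)
    (E F : Matrix (Fin N) (Fin r) ℂ) (G₀ : Matrix (Fin N) (Fin p) ℂ)
    (H₁ : Fin r → Fin r → Matrix (Fin N) (Fin p) ℂ) (q : Fin r → Polynomial ℂ) (i₀ a : Fin r),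
    (∀ X : Matrix (Fin r) (Fin r) ℂ, (∑ a : Fin r, ∑ b : Fin r, X a b • T a b) * E = F * X) →
    (∀ a b, T a b - (Matrix.of fun i j : Fin N => if (i : ℕ) = (j : ℕ) + 1 then (1 : ℂ) else 0) *
      T a b * (Matrix.of fun i j : Fin N => if (i : ℕ) = (j : ℕ) + 1 then (1 : ℂ) else 0)ᵀ =
      G₀ * (H₁ a b)ᵀ) →
    (∀ i : Fin r, (q i).natDegree ≤ k) →
    (∀ i : Fin r, q i ≠ 0 → ∀ n : Fin N, N ≤ (n : ℕ) + k → E n i = 0) →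
    (∑ i : Fin r, (Polynomial.aeval
      (Matrix.of fun i j : Fin N => if (i : ℕ) = (j : ℕ) + 1 then (1 : ℂ) else 0) (q i)) *ᵥ
      (fun n => E n i) = 0) →
    (Polynomial.aeval (Matrix.of fun i j : Fin N => if (i : ℕ) = (j : ℕ) + 1 then (1 : ℂ) else 0)
      (q i₀)) *ᵥ (fun n => F n a) ∈
      Submodule.span ℂ {v : Fin N → ℂ | ∃ (j : ℕ) (l : Fin p), j < k ∧
        v = ((Matrix.of fun i j : Fin N => if (i : ℕ) = (j : ℕ) + 1 then (1 : ℂ) else 0) ^ j) *ᵥ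
          (fun n => G₀ n l)} := by
  intro r N p k T E F G₀ H₁ q i₀ a hcorner hdisp hdeg hnov hsyz
  have hS := hclR_sd_disp_eval T G₀ H₁ hdisp (Matrix.single a i₀ (1 : ℂ))
  refine hclR_syz_assemble _
    (∑ a' : Fin r, ∑ b' : Fin r, Matrix.single a i₀ (1 : ℂ) a' b' • T a' b')
    (fun i => Polynomial.aeval
      (Matrix.of fun i j : Fin N => if (i : ℕ) = (j : ℕ) + 1 then (1 : ℂ) else 0) (q i))
    (fun i n => E n i) (fun n => F n a) i₀
    (hclR_syz_col_of_corner _ E F i₀ a (hcorner (Matrix.single a i₀ (1 : ℂ)))) (fun i => ?_) hsyz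
  by_cases hq : q i = 0
  · simp only [hq, map_zero, Matrix.zero_mulVec, Matrix.mulVec_zero, sub_self]
    exact Submodule.zero_mem _
  · exact hclR_syz_aeval_comm_mem _ G₀ _ hS k (q i) (hdeg i) _ (hnov i hq)

end Summit.MatrixMultiplication.MatrixMultiplication.Theorems
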